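import Literature.Geometry.Lorentzian.HawkingCrushBoundProofs
import Literature.Geometry.Lorentzian.HawkingSingularityPrelim
import Literature.Geometry.Lorentzian.HawkingMaximiserPrelim
import Literature.Geometry.Lorentzian.RadialCausalCone
import Literature.Geometry.Lorentzian.HypersurfaceRestriction
import Literature.Geometry.Riemannian.EndmanifoldVariation
import Literature.Geometry.Riemannian.VariationEnergyTaylor
import Literature.Geometry.Riemannian.ExpMapCovDerivLift
import Literature.Geometry.Riemannian.JacobiVariation
import HarnessLib

/-!
# Hawking's crush bound: the first variation along a maximising geodesic (normality)

Towards the MAXIMISER HALF `hmax` of `HawkingCrushBound_of_maximiser_of_secondVariation`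
(`HawkingCrushBoundProofs.lean`): O'Neill 1983, Ch. 14, Thm. 14.44 ("by Corollary 10.26, `γ` is
normal to `S`"). We prove the first-variation inequality behind Cor. 10.26 directly from
maximality, for the tree's everywhere-differentiable causal curves:

* `firstVariation_of_maximal` — let `f : N → M` be a smooth spacelike immersion of a
  `3`-manifold into a four-dimensional spacetime, `νt` a smooth field along `f` whose value
  `v₀ = νt(y₀)` is future timelike with `g(v₀, v₀) = -c₀²`, and suppose the geodesic
  `γ(t) = exp_{f y₀}(t v₀)`, `t ∈ [0, L₀]`, is length-maximising among the future causal curves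
  from `f(N)` to `γ(L₀)` (all of length `≤ c₀ L₀ = L(γ)`). Then `g(df_{y₀} w₀, v₀) ≤ 0` for
  every `w₀ ∈ T_{y₀}N` — hence, applied to `± w₀`, `γ'(0) ⊥ df(T_{y₀}N)`: the maximising geodesic
  is NORMAL to the hypersurface.

Proof: the endmanifold variation `x` of `γ` with variation field `V`, `V(0) = df w₀`,
`V(L₀) = 0` (`exists_endmanifold_variation`, O'Neill's Lemma 10.49) has future timelike
longitudinal curves from `f(N)` to `γ(L₀)` for small `σ`, of length `≤ c₀ L₀` by maximality,
while `-g(∂_t x, ∂_t x) ≥ c₀² - 2σ g(V', γ') - σ²(h + 1)` (`val_velocity_le_taylor`, O'Neill's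
Lemma 10.38); the limiting argument `integral_nonneg_of_sqrt_integral_le_linear` gives
`∫₀ᴸ⁰ g(V', γ') ≥ 0`, and `∫₀ᴸ⁰ g(V', γ') = [g(V, γ')]₀ᴸ⁰ = -g(df w₀, v₀)` since `γ` is a geodesic
(O'Neill 1983, Ch. 10, Prop. 10.2: `L'(0) = -(ε/c) [⟨V, γ'⟩]` for a geodesic).

No definitions and no named facts are introduced (D-0026).

## References

* B. O'Neill, *Semi-Riemannian geometry with applications to relativity*, Academic Press 1983,
  Ch. 10, Prop. 10.2, Cor. 10.26, Lemma 10.38, Lemma 10.49; Ch. 14, Thm. 14.44 (p. 427).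
  [ONeillSemiRiemannian1983]
* R. M. Wald, *General Relativity*, Chicago 1984, Thm. 9.4.3 ("a curve … which maximizes the
  length … must be a geodesic orthogonal to `Σ`"), Thm. 9.5.1. [Wald1984GR]
-/

noncomputable section

open Bundle Set Filter Function Manifold MeasureTheory
open scoped Manifold ContDiff Topology ENNReal

universe u

namespace Literature.Geometry.Lorentzian

open Literature.Geometry.Riemannian PseudoRiemannianMetric

set_option maxHeartbeats 800000 in
/-- **First variation: a maximising geodesic from a spacelike hypersurface is normal to it**
(O'Neill 1983, Ch. 10, Prop. 10.2 and Cor. 10.26; Ch. 14, proof of Thm. 14.44; Wald 1984,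
Thm. 9.4.3). In a four-dimensional spacetime let `f : N → M` be a smooth spacelike immersion of a
`3`-manifold and `νt` a field along `f` with `C^∞` lift whose value `νt(y₀)` is future directed
with `g(νt y₀, νt y₀) = -c₀²`, `c₀ > 0`; let the geodesic `γ(t) = exp_{f y₀}(t νt(y₀))` be defined
on `(a, b) ⊇ [0, L₀]`, `L₀ > 0`, and suppose every future causal curve from a point of `f(N)` to
`γ(L₀)` has length `≤ c₀ L₀`. Then for every field `V` along `γ` with `C^∞` lift on `(a, b)`,
`V(L₀) = 0` and `V(0) = df_{y₀}(w₀)`: `g(df_{y₀} w₀, νt y₀) ≤ 0`.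
[cite: ONeillSemiRiemannian1983, Ch. 10, Prop. 10.2 and Cor. 10.26; Ch. 14, Thm. 14.44]
[cite: Wald1984GR, Thm. 9.4.3] -/
theorem firstVariation_of_maximal (𝓢 : Spacetime.{u} 4)
    [𝓢.metric.HasLeviCivita]
    {N : Type u} [TopologicalSpace N] [ChartedSpace E3 N] [IsManifold (𝓡 3) ∞ N]
    {f : N → 𝓢.carrier} (hf : 𝓢.metric.IsSpacelikeImmersion (𝓡 3) f) {νt : NormalField (𝓡 4) f}
    (hνt : ContMDiff (𝓡 3) (𝓡 4).tangent ∞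
      (fun y ↦ (TotalSpace.mk' E4 (f y) (νt y) : TangentBundle (𝓡 4) 𝓢.carrier)))
    {y₀ : N} {c₀ : ℝ} (hc₀ : 0 < c₀) (hvv : 𝓢.metric.val (f y₀) (νt y₀) (νt y₀) = -c₀ ^ 2)
    (hfut : 𝓢.timeOrientation.IsFutureDirected (νt y₀))
    {L₀ a b : ℝ} (ha : a < 0) (hL₀ : 0 < L₀) (hb : L₀ < b)
    (hdom : Ioo a b ⊆ maximalGeodesicDomain 𝓢.metric.leviCivita (f y₀) (νt y₀))
    (hmax : ∀ (y' : N) (γ : ℝ → 𝓢.carrier) (a b : ℝ), a < b →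
      𝓢.metric.IsFutureCausalCurveOn 𝓢.timeOrientation γ (Icc a b) → γ a = f y' →
      γ b = expMap 𝓢.metric.leviCivita (f y₀) (L₀ • νt y₀) →
      𝓢.metric.arcLength γ a b ≤ ENNReal.ofReal (c₀ * L₀))
    {V : Π t : ℝ, TangentSpace (𝓡 4) (expMap 𝓢.metric.leviCivita (f y₀) (t • νt y₀))}
    (hV : ∀ t ∈ Ioo a b, ContMDiffAt 𝓘(ℝ, ℝ) (𝓡 4).tangent ∞
      (fun t ↦ (TotalSpace.mk' E4 (expMap 𝓢.metric.leviCivita (f y₀) (t • νt y₀)) (V t) :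
        TangentBundle (𝓡 4) 𝓢.carrier)) t)
    (hVL : V L₀ = 0) {w₀ : TangentSpace (𝓡 3) y₀} (hV0 : V 0 = mfderiv (𝓡 3) (𝓡 4) f y₀ w₀) :
    𝓢.metric.val (f y₀) (mfderiv (𝓡 3) (𝓡 4) f y₀ w₀) (νt y₀) ≤ 0 := by
  classical
  /- 0. Notation and regularity. -/
  let γ : ℝ → 𝓢.carrier := fun t ↦ expMap 𝓢.metric.leviCivita (f y₀) (t • νt y₀)
  let M := 𝓢.carrier
  let g := 𝓢.metric
  let τ := 𝓢.timeOrientation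
  let cov := 𝓢.metric.leviCivita
  have hk1 : (((1 : ℕ∞) : ℕ∞ω)) + 1 ≤ ((⊤ : ℕ∞) : ℕ∞ω) := by exact_mod_cast le_top
  have hkT : (((⊤ : ℕ∞) : ℕ∞ω)) + 1 ≤ ((⊤ : ℕ∞) : ℕ∞ω) := by exact_mod_cast le_top
  have hreg₁ : cov.IsLocallyContMDiff 1 := 𝓢.metric.isLocallyContMDiff_leviCivita_holds 1 hk1
  have hreg : cov.IsLocallyContMDiff ∞ := 𝓢.metric.isLocallyContMDiff_leviCivita_holds ⊤ hkT
  haveI : CovariantDerivative.ContMDiffCovariantDerivative cov 1 := ⟨hreg₁ univ isOpen_univ⟩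
  haveI : CovariantDerivative.ContMDiffCovariantDerivative cov (⊤ : ℕ∞) :=
    ⟨hreg univ isOpen_univ⟩
  have hn : ((⊤ : ℕ∞) : ℕ∞ω) ≤ ((⊤ : ℕ∞) : ℕ∞ω) := le_rfl
  have hTne : ((⊤ : ℕ∞) : ℕ∞ω) ≠ 0 := by simp
  have hLC : g.IsLeviCivita cov := isLeviCivita_leviCivita_holds (g := g.toPseudoRiemannianMetric)
  /- 1. The normal geodesic. -/
  obtain ⟨hmaxg, h0D, -, -⟩ := maximalGeodesic_spec' (cov := cov) (f y₀) (νt y₀)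
  let D := maximalGeodesicDomain cov (f y₀) (νt y₀)
  have hDo : IsOpen D := hmaxg.isOpen
  have hgeo : IsGeodesicOn cov γ D := isGeodesicOn_expMap_smul (cov := cov) (f y₀) (νt y₀)
  have hv0 : velocity (𝓡 4) γ 0 = νt y₀ := velocity_expMap_smul_zero (cov := cov) (f y₀) (νt y₀)
  have hγ0 : γ 0 = f y₀ := by
    show expMap cov (f y₀) ((0 : ℝ) • νt y₀) = f y₀
    rw [zero_smul]
    exact expMap_zero (cov := cov) (f y₀)
  have hc2 : 0 < c₀ ^ 2 := by positivity
  have hνtl : g.IsTimelike (νt y₀) := by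
    show g.val (f y₀) (νt y₀) (νt y₀) < 0
    rw [hvv]
    linarith
  have hunit : ∀ t ∈ D, g.val (γ t) (velocity (𝓡 4) γ t) (velocity (𝓡 4) γ t) = -c₀ ^ 2 := by
    intro t ht
    have h := g.toPseudoRiemannianMetric.val_velocity_eq_of_isGeodesicOn_holds hDo hmaxg.2.1
      hgeo ht h0D
    rw [hv0, hγ0] at h
    exact h.trans hvv
  have hfd : ∀ t ∈ D, g.IsTimelike (velocity (𝓡 4) γ t) ∧ τ.IsFutureDirected (velocity (𝓡 4) γ t) :=
    fun t ht ↦ isTimelike_isFutureDirected_velocity_expMap_smul τ hνtl hfut ht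
  have hIccD : Icc 0 L₀ ⊆ D := fun t ht ↦ hdom ⟨ha.trans_le ht.1, ht.2.trans_lt hb⟩
  /- 2. The endmanifold variation. -/
  have hι : Injective (mfderiv (𝓡 3) (𝓡 4) f y₀) := hf.injective_mfderiv y₀
  have hνz : νt y₀ ∉ range (mfderiv (𝓡 3) (𝓡 4) f y₀) := by
    rintro ⟨v, hv⟩
    have h1 : 0 ≤ g.val (f y₀) (mfderiv (𝓡 3) (𝓡 4) f y₀ v) (mfderiv (𝓡 3) (𝓡 4) f y₀ v) := by
      by_cases hv0' : v = 0
      · rw [hv0', (mfderiv (𝓡 3) (𝓡 4) f y₀).map_zero, map_zero]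
      · exact (hf.inducedBilin_pos (I' := 𝓡 3) y₀ hv0').le
    rw [hv, hvv] at h1
    linarith
  have hdim : Module.finrank ℝ E3 + 1 = Module.finrank ℝ E4 := by simp
  obtain ⟨x, ζ, hxs, hζs, hζ0, hζv, hx0, hxL, hxγ, hxV⟩ :=
    exists_endmanifold_variation (I := 𝓡 4) (I' := 𝓡 3) (ι := f) (ν := νt) (cov := cov) hνt hι
      hνz hdim ha hL₀ hb hdom hV hVL hV0
  /- 3. The fields `T = ∂_t x`, `S = ∂_σ x`, `D_t S`, `A = D_σ S`, `D_t A` and their smooth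
  lifts. -/
  have hT : ContMDiff (𝓘(ℝ, ℝ).prod 𝓘(ℝ, ℝ)) (𝓡 4).tangent ∞ (fun q : ℝ × ℝ ↦
      (TotalSpace.mk' E4 (x q.1 q.2) (velocity (𝓡 4) (fun t' ↦ x t' q.2) q.1) :
        TangentBundle (𝓡 4) M)) :=
    contMDiff_lift_velocity_uncurry_left hxs
  have hswap : ContMDiff (𝓘(ℝ, ℝ).prod 𝓘(ℝ, ℝ)) (𝓘(ℝ, ℝ).prod 𝓘(ℝ, ℝ)) ∞
      (fun q : ℝ × ℝ ↦ ((q.2, q.1) : ℝ × ℝ)) := contMDiff_snd.prodMk contMDiff_fst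
  have hS : ContMDiff (𝓘(ℝ, ℝ).prod 𝓘(ℝ, ℝ)) (𝓡 4).tangent ∞ (fun q : ℝ × ℝ ↦
      (TotalSpace.mk' E4 (x q.1 q.2) (velocity (𝓡 4) (x q.1) q.2) : TangentBundle (𝓡 4) M)) := by
    have hx' : ContMDiff (𝓘(ℝ, ℝ).prod 𝓘(ℝ, ℝ)) (𝓡 4) ∞ (uncurry fun s t ↦ x t s) :=
      hxs.comp hswap
    exact (contMDiff_lift_velocity_uncurry_left hx').comp hswap
  have hDtS : ContMDiff (𝓘(ℝ, ℝ).prod 𝓘(ℝ, ℝ)) (𝓡 4).tangent ∞ (fun q : ℝ × ℝ ↦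
      (TotalSpace.mk' E4 (x q.1 q.2) (covariantDerivAlong cov (fun t' ↦ x t' q.2)
        (fun t' ↦ velocity (𝓡 4) (x t') q.2) q.1) : TangentBundle (𝓡 4) M)) :=
    contMDiff_lift_covariantDerivAlong_curry_left (cov := cov) hreg (x := x)
      (Z := fun t s ↦ velocity (𝓡 4) (x t) s) hxs hS
  have hA : ContMDiff (𝓘(ℝ, ℝ).prod 𝓘(ℝ, ℝ)) (𝓡 4).tangent ∞
      (fun q : ℝ × ℝ ↦ (TotalSpace.mk' E4 (x q.1 q.2)
        (covariantDerivAlong cov (x q.1) (fun s' ↦ velocity (𝓡 4) (x q.1) s') q.2) :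
          TangentBundle (𝓡 4) M)) :=
    contMDiff_lift_covariantDerivAlong_curry_right (cov := cov) hreg (x := x)
      (Z := fun t s ↦ velocity (𝓡 4) (x t) s) hxs hS
  have hDtA : ContMDiff (𝓘(ℝ, ℝ).prod 𝓘(ℝ, ℝ)) (𝓡 4).tangent ∞
      (fun q : ℝ × ℝ ↦ (TotalSpace.mk' E4 (x q.1 q.2)
        (covariantDerivAlong cov (fun t' ↦ x t' q.2)
          (fun t' ↦ covariantDerivAlong cov (x t') (fun s' ↦ velocity (𝓡 4) (x t') s') q.2) q.1) :
          TangentBundle (𝓡 4) M)) :=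
    contMDiff_lift_covariantDerivAlong_curry_left (cov := cov) hreg (x := x)
      (Z := fun t s ↦ covariantDerivAlong cov (x t) (fun s' ↦ velocity (𝓡 4) (x t) s') s) hxs hA
  have hτx : ContMDiff (𝓘(ℝ, ℝ).prod 𝓘(ℝ, ℝ)) (𝓡 4).tangent ∞ (fun q : ℝ × ℝ ↦
      (TotalSpace.mk' E4 (x q.1 q.2) (τ.vectorField (x q.1 q.2)) : TangentBundle (𝓡 4) M)) :=
    τ.contMDiff.comp hxs
  /- 4. The scalar functions. -/
  let fTT : ℝ × ℝ → ℝ := fun q ↦ g.val (x q.1 q.2) (velocity (𝓡 4) (fun t' ↦ x t' q.2) q.1)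
    (velocity (𝓡 4) (fun t' ↦ x t' q.2) q.1)
  have hfTT : fTT = fun q ↦ g.val (x q.1 q.2) (velocity (𝓡 4) (fun t' ↦ x t' q.2) q.1)
    (velocity (𝓡 4) (fun t' ↦ x t' q.2) q.1) := rfl
  let fτT : ℝ × ℝ → ℝ := fun q ↦ g.val (x q.1 q.2) (τ.vectorField (x q.1 q.2))
    (velocity (𝓡 4) (fun t' ↦ x t' q.2) q.1)
  have hfτT : fτT = fun q ↦ g.val (x q.1 q.2) (τ.vectorField (x q.1 q.2))
    (velocity (𝓡 4) (fun t' ↦ x t' q.2) q.1) := rfl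
  let hacc : ℝ × ℝ → ℝ := fun q ↦ g.val (x q.1 q.2)
    (covariantDerivAlong cov (fun t' ↦ x t' q.2)
      (fun t' ↦ covariantDerivAlong cov (x t') (fun s' ↦ velocity (𝓡 4) (x t') s') q.2) q.1)
    (velocity (𝓡 4) (fun t' ↦ x t' q.2) q.1)
  let hcurv : ℝ × ℝ → ℝ := fun q ↦ g.val (x q.1 q.2)
    (cov.curvature (x q.1 q.2) (velocity (𝓡 4) (x q.1) q.2)
      (velocity (𝓡 4) (fun t' ↦ x t' q.2) q.1) (velocity (𝓡 4) (x q.1) q.2))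
    (velocity (𝓡 4) (fun t' ↦ x t' q.2) q.1)
  let hvel : ℝ × ℝ → ℝ := fun q ↦ g.val (x q.1 q.2)
    (covariantDerivAlong cov (fun t' ↦ x t' q.2) (fun t' ↦ velocity (𝓡 4) (x t') q.2) q.1)
    (covariantDerivAlong cov (fun t' ↦ x t' q.2) (fun t' ↦ velocity (𝓡 4) (x t') q.2) q.1)
   
  let hh : ℝ × ℝ → ℝ := fun q ↦ hacc q + hcurv q + hvel q
  have hhh : hh = fun q ↦ hacc q + hcurv q + hvel q := rfl
  have hfTTs : ContMDiff (𝓘(ℝ, ℝ).prod 𝓘(ℝ, ℝ)) 𝓘(ℝ, ℝ) ∞ fTT := fun q ↦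
    contMDiffAt_val_apply_along g.toPseudoRiemannianMetric hn (hT q) (hT q)
  have hfτTs : ContMDiff (𝓘(ℝ, ℝ).prod 𝓘(ℝ, ℝ)) 𝓘(ℝ, ℝ) ∞ fτT := fun q ↦
    contMDiffAt_val_apply_along g.toPseudoRiemannianMetric hn (hτx q) (hT q)
  have haccs : ContMDiff (𝓘(ℝ, ℝ).prod 𝓘(ℝ, ℝ)) 𝓘(ℝ, ℝ) ∞ hacc := fun q ↦
    contMDiffAt_val_apply_along g.toPseudoRiemannianMetric hn (hDtA q) (hT q)
  have hvels : ContMDiff (𝓘(ℝ, ℝ).prod 𝓘(ℝ, ℝ)) 𝓘(ℝ, ℝ) ∞ hvel := fun q ↦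
    contMDiffAt_val_apply_along g.toPseudoRiemannianMetric hn (hDtS q) (hDtS q)
  -- continuity of the full second-order coefficient (O'Neill's Lemma 10.38)
  obtain ⟨hhc, htaylor⟩ := val_velocity_le_taylor g.toPseudoRiemannianMetric hn hxs 0 L₀
  have hhc' : Continuous hh := hhc
  have hcurvc : Continuous hcurv := by
    have : hcurv = fun q ↦ hh q - hacc q - hvel q := by
      funext q
      simp only [hhh]
      ring
    rw [this]
    exact (hhc'.sub haccs.continuous).sub hvels.continuous
  /- 5. Identification along `σ = 0`. -/
  obtain ⟨O', hO'o, hO'sub, hO'p⟩ := eventually_nhdsSet_iff_exists.1 (hxγ.and hxV)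
  let O : Set ℝ := O' ∩ Ioo a b
  have hO : O = O' ∩ Ioo a b := rfl
  have hOo : IsOpen O := hO'o.inter isOpen_Ioo
  have hOsub : Icc 0 L₀ ⊆ O := subset_inter hO'sub (Icc_subset_Ioo ha hb)
  have hOp : ∀ t ∈ O, x t 0 = γ t ∧ velocity (𝓡 4) (x t) 0 = V t := fun t ht ↦ hO'p t ht.1
  have hOD : O ⊆ D := fun t ht ↦ hdom ht.2
  have hcz0 : ∀ t ∈ O, (fun t' ↦ x t' 0) =ᶠ[𝓝 t] γ := fun t ht ↦
    Filter.eventually_of_mem (hOo.mem_nhds ht) fun t' ht' ↦ (hOp t' ht').1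
  have hT0 : ∀ t ∈ O, velocity (𝓡 4) (fun t' ↦ x t' 0) t = velocity (𝓡 4) γ t := fun t ht ↦
    velocity_congr_of_eventuallyEq (I := 𝓡 4) (hcz0 t ht)
  have hS0 : ∀ t ∈ O, velocity (𝓡 4) (x t) 0 = V t := fun t ht ↦ (hOp t ht).2
  have hlift0 : ∀ t ∈ O, (fun t' ↦ (TotalSpace.mk' E4 (x t' 0) (velocity (𝓡 4) (x t') 0) :
      TangentBundle (𝓡 4) M)) =ᶠ[𝓝 t]
      fun t' ↦ (TotalSpace.mk' E4 (γ t') (V t') : TangentBundle (𝓡 4) M) := by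
    intro t ht
    filter_upwards [hOo.mem_nhds ht] with t' ht'
    obtain ⟨h1, h2⟩ := hOp t' ht'
    show TotalSpace.mk' E4 (x t' 0) (velocity (𝓡 4) (x t') 0) = TotalSpace.mk' E4 (γ t') (V t')
    rw [h2, h1]
  have hDtS0 : ∀ t ∈ O, covariantDerivAlong cov (fun t' ↦ x t' 0)
      (fun t' ↦ velocity (𝓡 4) (x t') 0) t = covariantDerivAlong cov γ V t := fun t ht ↦
    covariantDerivAlong_congr_of_eventuallyEq cov (hlift0 t ht)
  have hTT0 : ∀ t ∈ O, fTT (t, 0) = -c₀ ^ 2 := by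
    intro t ht
    simp only [hfTT, hT0 t ht]
    rw [(hOp t ht).1]
    exact hunit t (hOD ht)
  have h0O : (0 : ℝ) ∈ O := hOsub ⟨le_rfl, hL₀.le⟩
  /- 6. The Taylor bound: `-g(T,T)(t, σ) ≥ c₀² - σ (2 k(t)) - σ²(h(t, 0) + 1)` with
  `k(t) = g(D_t V, γ')`. -/
  let kF : ℝ × ℝ → ℝ := fun q ↦ g.val (x q.1 q.2)
    (covariantDerivAlong cov (fun t' ↦ x t' q.2) (fun t' ↦ velocity (𝓡 4) (x t') q.2) q.1)
    (velocity (𝓡 4) (fun t' ↦ x t' q.2) q.1)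
  have hkFs : ContMDiff (𝓘(ℝ, ℝ).prod 𝓘(ℝ, ℝ)) 𝓘(ℝ, ℝ) ∞ kF := fun q ↦
    contMDiffAt_val_apply_along g.toPseudoRiemannianMetric hn (hDtS q) (hT q)
  let kf : ℝ → ℝ := fun t ↦ kF (t, 0)
  have hkfc : Continuous kf := hkFs.continuous.comp (continuous_id.prodMk continuous_const)
  obtain ⟨δ, hδ, hδp⟩ := htaylor 1 one_pos
  have htaylor' : ∀ σ ∈ Icc (0 : ℝ) δ, ∀ t ∈ Icc 0 L₀,
      c₀ ^ 2 - σ * (2 * kf t) - σ ^ 2 * (hh (t, 0) + 1) ≤ -fTT (t, σ) := by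
    intro σ hσ t ht
    have hO := hOsub ht
    have h1 : fTT (t, σ) ≤ fTT (t, 0) + σ * (2 * kf t) + σ * σ * (hh (t, 0) + 1) := hδp σ hσ t ht
    rw [hTT0 t hO] at h1
    have hsq : σ ^ 2 = σ * σ := sq σ
    rw [hsq]
    linarith
  /- 7. The longitudinal curves near `σ = 0` are future timelike. -/
  have hneg0 : ∀ t ∈ Icc 0 L₀, fTT (t, 0) < 0 ∧ fτT (t, 0) < 0 := by
    intro t ht
    have hO := hOsub ht
    refine ⟨by rw [hTT0 t hO]; linarith, ?_⟩
    simp only [hfτT, hT0 t hO]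
    rw [(hOp t hO).1]
    exact (hfd t (hIccD ht)).2.2
  let W : Set (ℝ × ℝ) := {q | fTT q < 0 ∧ fτT q < 0}
  have hWo : IsOpen W :=
    (isOpen_lt hfTTs.continuous continuous_const).inter
      (isOpen_lt hfτTs.continuous continuous_const)
  have hKW : Icc 0 L₀ ×ˢ ({0} : Set ℝ) ⊆ W := by
    rintro ⟨t, σ⟩ ⟨ht, hσ⟩
    rw [mem_singleton_iff] at hσ
    subst hσ
    exact hneg0 t ht
  obtain ⟨A₁, B₁, -, hB₁o, hA₁, hB₁, hAB₁⟩ :=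
    generalized_tube_lemma isCompact_Icc isCompact_singleton hWo hKW
  obtain ⟨δ₁, hδ₁, hδ₁sub⟩ : ∃ δ₁ > 0, Icc (0 : ℝ) δ₁ ⊆ B₁ := by
    obtain ⟨ε, hε, hεsub⟩ := Metric.isOpen_iff.1 hB₁o 0 (hB₁ rfl)
    refine ⟨ε / 2, by positivity, fun σ hσ ↦ hεsub ?_⟩
    rw [Metric.mem_ball, Real.dist_eq, sub_zero, abs_lt]
    constructor <;> linarith [hσ.1, hσ.2]
  have htube : ∀ σ ∈ Icc (0 : ℝ) δ₁, ∀ t ∈ Icc 0 L₀, fTT (t, σ) < 0 ∧ fτT (t, σ) < 0 :=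
    fun σ hσ t ht ↦ hAB₁ (mk_mem_prod (hA₁ ht) (hδ₁sub hσ))
  /- 8. Maximality: `∫₀ᴸ⁰ √(-g(T,T)(t, σ)) dt ≤ c₀ L₀` for `σ ∈ (0, δ₁]`. -/
  have hcurve : ∀ σ ∈ Icc (0 : ℝ) δ₁, g.IsFutureCausalCurveOn τ (fun t ↦ x t σ) (Icc 0 L₀) := by
    intro σ hσ t ht
    refine ⟨((hxs.comp (contMDiff_id.prodMk contMDiff_const)) t).mdifferentiableAt hTne, ?_⟩
    obtain ⟨h1, h2⟩ := htube σ hσ t ht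
    have h1' : g.IsTimelike (velocity (𝓡 4) (fun t' ↦ x t' σ) t) := h1
    exact ⟨h1'.isCausal, h2⟩
  have hlen : ∀ σ ∈ Ioc (0 : ℝ) δ₁, (∫ t in (0 : ℝ)..L₀, Real.sqrt (-fTT (t, σ))) ≤ c₀ * L₀ := by
    intro σ hσ
    have hσ' : σ ∈ Icc (0 : ℝ) δ₁ := ⟨hσ.1.le, hσ.2⟩
    have h1 := hmax (ζ σ) (fun t ↦ x t σ) 0 L₀ hL₀ (hcurve σ hσ') (hx0 σ) (hxL σ)
    have hspeed : ∀ t ∈ Icc 0 L₀, g.toPseudoRiemannianMetric.speed (fun t' ↦ x t' σ) t =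
        Real.sqrt (-fTT (t, σ)) := fun t ht ↦
      speed_eq_sqrt_neg_of_nonpos (le_of_lt (htube σ hσ' t ht).1)
    have hcont : Continuous (fun t ↦ Real.sqrt (-fTT (t, σ))) :=
      Real.continuous_sqrt.comp
        ((hfTTs.continuous.comp (continuous_id.prodMk continuous_const)).neg)
    have harc : g.arcLength (fun t' ↦ x t' σ) 0 L₀ =
        ENNReal.ofReal (∫ t in (0 : ℝ)..L₀, Real.sqrt (-fTT (t, σ))) := by
      rw [arcLength_eq_lintegral_Icc, intervalIntegral.integral_of_le hL₀.le,
        ← integral_Icc_eq_integral_Ioc, ofReal_integral_eq_lintegral_ofReal]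
      · exact setLIntegral_congr_fun measurableSet_Icc fun t ht ↦ by rw [hspeed t ht]
      · exact hcont.integrableOn_Icc
      · exact Eventually.of_forall fun t ↦ Real.sqrt_nonneg _
    rw [harc] at h1
    exact (ENNReal.ofReal_le_ofReal_iff (by positivity)).1 h1
  /- 9. The limiting argument: `∫₀ᴸ⁰ k(t) dt ≥ 0`. -/
  have hint : 0 ≤ ∫ t in (0 : ℝ)..L₀, kf t :=
    integral_nonneg_of_sqrt_integral_le_linear hL₀ hc₀ (k := kf) (r := fun t ↦ hh (t, 0) + 1)
      (N := fun t σ ↦ -fTT (t, σ)) hkfc.continuousOn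
      ((hhc'.comp (continuous_id.prodMk continuous_const)).add continuous_const).continuousOn
      (fun σ ↦ ((hfTTs.continuous.comp (continuous_id.prodMk continuous_const)).neg).continuousOn)
      (lt_min hδ hδ₁)
      (fun σ hσ ↦ ⟨hlen σ ⟨hσ.1, hσ.2.trans (min_le_right _ _)⟩,
        fun t ht ↦ htaylor' σ ⟨hσ.1.le, hσ.2.trans (min_le_left _ _)⟩ t ht⟩)
  /- 10. `∫₀ᴸ⁰ k = [g(V, γ')]₀ᴸ⁰ = -g(df w₀, νt y₀)` (`γ` is a geodesic). -/
  let cz : ℝ → M := fun t ↦ x t 0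
  let Sf : Π t : ℝ, TangentSpace (𝓡 4) (cz t) := fun t ↦ velocity (𝓡 4) (x t) 0
  let Tf : Π t : ℝ, TangentSpace (𝓡 4) (cz t) := fun t ↦ velocity (𝓡 4) cz t
  have hline0 : ContMDiff 𝓘(ℝ, ℝ) (𝓘(ℝ, ℝ).prod 𝓘(ℝ, ℝ)) ∞ (fun t : ℝ ↦ ((t, (0 : ℝ)) : ℝ × ℝ)) :=
    contMDiff_id.prodMk contMDiff_const
  have hSfd : ∀ t, MDifferentiableAt 𝓘(ℝ, ℝ) (𝓡 4).tangent
      (fun t ↦ (TotalSpace.mk' E4 (cz t) (Sf t) : TangentBundle (𝓡 4) M)) t := fun t ↦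
    ((hS.comp hline0) t).mdifferentiableAt hTne
  have hTfd : ∀ t, MDifferentiableAt 𝓘(ℝ, ℝ) (𝓡 4).tangent
      (fun t ↦ (TotalSpace.mk' E4 (cz t) (Tf t) : TangentBundle (𝓡 4) M)) t := fun t ↦
    ((hT.comp hline0) t).mdifferentiableAt hTne
  have hDtT0 : ∀ t ∈ O, covariantDerivAlong cov cz Tf t = 0 := fun t ht ↦ by
    show covariantDerivAlong cov cz (fun t ↦ velocity (𝓡 4) cz t) t = 0
    rw [covariantDerivAlong_velocity_congr (cov := cov) (hcz0 t ht)]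
    exact hgeo.2 t (hOD ht)
  have hderiv : ∀ t ∈ O, HasDerivAt (fun t ↦ g.val (cz t) (Sf t) (Tf t)) (kf t) t := by
    intro t ht
    have h := g.toPseudoRiemannianMetric.hasDerivAt_val_apply_along hLC.2 (hSfd t) (hTfd t)
    rw [hDtT0 t ht, map_zero, add_zero] at h
    exact h
  have hFTC : ∫ t in (0 : ℝ)..L₀, kf t =
      g.val (cz L₀) (Sf L₀) (Tf L₀) - g.val (cz 0) (Sf 0) (Tf 0) := by
    refine intervalIntegral.integral_eq_sub_of_hasDerivAt (fun t ht ↦ hderiv t (hOsub ?_)) ?_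
    · rwa [uIcc_of_le hL₀.le] at ht
    · exact hkfc.intervalIntegrable _ _
  have hL₀O : L₀ ∈ O := hOsub ⟨hL₀.le, le_rfl⟩
  have hSL : Sf L₀ = 0 := by
    show velocity (𝓡 4) (x L₀) 0 = 0
    rw [hS0 L₀ hL₀O]
    exact hVL
  have hS00 : Sf 0 = mfderiv (𝓡 3) (𝓡 4) f y₀ w₀ := by
    show velocity (𝓡 4) (x 0) 0 = _
    rw [hS0 0 h0O]
    exact hV0
  have hT00 : Tf 0 = νt y₀ := by
    show velocity (𝓡 4) cz 0 = νt y₀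
    rw [hT0 0 h0O, hv0]
  have hx00 : x 0 0 = f y₀ := (hOp 0 h0O).1.trans hγ0
  rw [hFTC, hSL, map_zero, zero_apply, zero_sub, hS00, hT00] at hint
  /- 11. Conclusion. -/
  have hfin : g.val (cz 0) (mfderiv (𝓡 3) (𝓡 4) f y₀ w₀) (νt y₀) =
      𝓢.metric.val (f y₀) (mfderiv (𝓡 3) (𝓡 4) f y₀ w₀) (νt y₀) := by
    show g.val (x 0 0) _ _ = _
    rw [hx00]
  linarith [hint, hfin]

end Literature.Geometry.Lorentzian

end
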